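import Summits.QuantumFields.YangMills.Theorems.DiagonalMirrorRPRWilsonDiagonalModelGlue

/-!
# Crux `DiagonalMirrorRPR` (stmt-QuantumFields-10604), line `sign-twisted-diagonal-trace`, construction F1_diag
# (director-ym O4 WORD 3 (A)), S4b: the cyclic `K_u`-chain of the odd torus over (bond half, in-slab half) PAIRS

Helper for the crux `DiagonalMirrorRPR` of `YangMills` (routes `IsotropyFromPowerCounting`, `MirrorModularBoosts`,
`PencilRigidity`; item stmt-QuantumFields-10604), attached `--supports … --as helper`; it closes nothing by itself.
Continuation of `…WilsonDiagonalModelGlue` (`glueEquiv`, measure preserving).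

* `stepKernelU_glue` — `K_u(glue(Y,X), glue(Y′,X′)) = e^{β even(Y,X,Y′)} e^{β odd(X,Y′,X′)}`;
* ★ **`diagCyclicTraceU_eq_integral_pairs`** — `diagCyclicTraceU ρ β m = ∫ ∏_t e^{β even(Y_t,X_t,Y_{t+1})} e^{β odd(X_t,Y_{t+1},X_{t+1})}
  d(halfHaar ⊗ halfHaar)^{⊗ ℤ_m}`: the `K_u`-chain ("`Tr A_k^m`" at kernel level, LANDED `…OddTorusChain`) in the form onto which the
  feature resummation (`hasSum_pi_prod_natFeature_mul`, `hasSum_expFeature_even`) folds the cyclic integral of the lifted kernel `𝔞`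
  — the path-integral half of the trace formulas `Σ κ_i^m = diagCyclicTraceU ρ β m` (the spectral half, OWED: kernels of powers of `𝔄`).

HONEST FRAMING: bookkeeping helper; no `def wilsonDiagonalModel`; nothing about D_old ⟨10604⟩, the RP crux of the FOLD restate, or
the summit is proved; the Yang–Mills mass gap is NOT proved here or anywhere in the tree.
-/

set_option autoImplicit false

noncomputable section

open MeasureTheory
open Literature.MathematicalPhysics.QuantumLattice Literature.MathematicalPhysics.QuantumFieldTheory
open Summit.QuantumFields.YangMills.Cruxes.DiagonalMirrorRPR.ParityBridgeColdTraces

namespace Summit.QuantumFields.YangMills.Cruxes.DiagonalMirrorRPR.SignTwistedDiagonalTrace.WilsonDiagonal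

/-! ## §22 The cyclic `K_u`-chain over half-layer pairs -/

section PairChain

variable {S : ℕ} [NeZero S] {G : Type} [Group G] {Nc : ℕ} (ρ : G →* Matrix (Fin Nc) (Fin Nc) ℂ)

/-- The two-step kernel on glued pairs is the product of the two half-step weights. -/
theorem stepKernelU_glue (β : ℝ) (Y X Y' X' : HalfCfg S S G) :
    stepKernelU ρ β (glue Y X) (glue Y' X') = Real.exp (β * evenActionU ρ Y X Y') * Real.exp (β * oddActionU ρ X Y' X') := by
  rw [stepKernelU_eq_even_mul_odd, bonds_glue, inslab_glue, bonds_glue, inslab_glue]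

variable [TopologicalSpace G] [IsTopologicalGroup G] [CompactSpace G] [MeasurableSpace G] [BorelSpace G]

/-- ★ **The cyclic chain over pairs**: `diagCyclicTraceU ρ β m = ∫ ∏_t e^{β even(Y_t, X_t, Y_{t+1})} e^{β odd(X_t, Y_{t+1}, X_{t+1})}
d(halfHaar ⊗ halfHaar)^{⊗m}` — the layers of the `K_u`-chain read as (bond half, in-slab half) pairs through the measure-preserving
`glueEquiv` (the form that the feature resummation `hasSum_pi_prod_natFeature_mul` folds the lifted kernel `𝔞` onto). -/
theorem diagCyclicTraceU_eq_integral_pairs (β : ℝ) (m : ℕ) [NeZero m] :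
    diagCyclicTraceU ρ β m (S := S) (G := G) =
      ∫ P : ZMod m → HalfCfg S S G × HalfCfg S S G,
        ∏ t : ZMod m, Real.exp (β * evenActionU ρ (P t).1 (P t).2 (P (t + 1)).1) *
          Real.exp (β * oddActionU ρ (P t).2 (P (t + 1)).1 (P (t + 1)).2)
        ∂(Measure.pi fun _ : ZMod m => (halfHaar S G).prod (halfHaar S G)) := by
  haveI : SigmaFinite (layerHaar S S G) := by unfold layerHaar; infer_instance
  haveI : SigmaFinite ((halfHaar S G).prod (halfHaar S G)) := by unfold halfHaar; infer_instance
  have hmp : MeasurePreserving (fun (P : ZMod m → HalfCfg S S G × HalfCfg S S G) (t : ZMod m) => glueEquiv (P t))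
      (Measure.pi fun _ : ZMod m => (halfHaar S G).prod (halfHaar S G)) (Measure.pi fun _ : ZMod m => layerHaar S S G) :=
    measurePreserving_pi _ _ fun _ => measurePreserving_glueEquiv
  unfold diagCyclicTraceU
  rw [← hmp.integral_comp (MeasurableEquiv.piCongrRight fun _ : ZMod m =>
    (glueEquiv : HalfCfg S S G × HalfCfg S S G ≃ᵐ LayerCfg S S G)).measurableEmbedding]
  refine integral_congr_ae (ae_of_all _ fun P => ?_)
  refine Finset.prod_congr rfl fun t _ => ?_
  dsimp only
  rw [show glueEquiv (P t) = glue (P t).1 (P t).2 from glueEquiv_apply (P t).1 (P t).2,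
    show glueEquiv (P (t + 1)) = glue (P (t + 1)).1 (P (t + 1)).2 from glueEquiv_apply (P (t + 1)).1 (P (t + 1)).2,
    stepKernelU_glue]

end PairChain

end Summit.QuantumFields.YangMills.Cruxes.DiagonalMirrorRPR.SignTwistedDiagonalTrace.WilsonDiagonal

end
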